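import Summits.ValiantsHypothesis.ValiantsHypothesis.Theorems.TwoProducts.RankThreeAffineTrinomial
import Summits.ValiantsHypothesis.ValiantsHypothesis.Theorems.TwoProducts.RankTwoJacobianShiftedSpecials

/-!
# Rank three AFFINE, T1-A′ UNCONDITIONAL: `nv (w₀^a + ρ·w₁^b − κ·w₂^d) ≤ 2·(9t¹⁶ + 4t⁶ + 7t² + 6t + 4) + 4`

The DISCHARGE of crit-8's T1-A′ split (rulings #66/#68/#70/#72, 2026-08-29): FILE A (val-port-1 g5, ✓ `…RankTwoJacobianShiftedAxial` +
✓ `…RankTwoJacobianShiftedSpecials`: the shifted axial transfer `shiftedAxialTransfer`, its per-cell count `card_SpecShift_le'` and the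
one-call template `Eset_subset_of_shifted`, packaged as ✓ `exists_shiftSpecial_bound`) proves the `Prop` hypothesis `ShiftedAxialBound` of
FILE B (val-port-4 g4, ✓ `…RankThreeAffineTrinomial`), so the Fermat-trinomial headline and `TrinomialAffineLaw` hold with NO hypothesis.
SIDE-LADDER located instance of the OPEN rung 3-AFF (`…Cruxes.TwoProducts.ValIdea35g10.RankThreeAffineLaw`); NOT γ; `TwoProducts` (5906),
`PlanarCellBound`, `ResidualLawV25` UNMOVED; 0 summit distance; VP ≠ VNP is NOT proved here or anywhere in this tree.
`--supports stmt-ValiantsHypothesis-5906 --as helper`.  No instances, no notation, no named facts, no new definitions. [folklore]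
-/

noncomputable section
set_option linter.dupNamespace false

namespace Summit.ValiantsHypothesis.ValiantsHypothesis.Theorems.TwoProducts.RankTwoJacobian

open scoped BigOperators Pointwise Classical
open MvPolynomial

/-- ★ **FILE A discharges FILE B's hypothesis:** `ShiftedAxialBound` holds (✓ `exists_shiftSpecial_bound`, `SS := SpecShift σ v G N`). -/
theorem shiftedAxialBound : ShiftedAxialBound :=
  fun _ hσ _ _ _ _ _ _ hv hG hM hid => exists_shiftSpecial_bound hσ hv hG hM hid

/-- ★★ **T1-A′ SETTLED (uniform, unconditional).** For `t`-sparse carriers `w₀, w₁, w₂ ∈ ℂ[x,y]` and ANY `a, b, d : ℕ`, `ρ, κ : ℂ`: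
`nv (w₀^a + ρ·w₁^b − κ·w₂^d) ≤ 2·(9t¹⁶ + 4t⁶ + 7t² + 6t + 4) + 4`. -/
theorem trinomialAffine_nv_le' {t : ℕ} (w : Fin 3 → Poly2) (hw : ∀ i, (w i).support.card ≤ t) (a b d : ℕ) (ρ κ : ℂ) :
    nv (w 0 ^ a + C ρ * w 1 ^ b - C κ * w 2 ^ d) ≤ 2 * (9 * t ^ 16 + 4 * t ^ 6 + 7 * t ^ 2 + 6 * t + 4) + 4 :=
  trinomialAffine_nv_le shiftedAxialBound w hw a b d ρ κ

/-- ★ **`TrinomialAffineLaw` holds** (crit-8 g4's T1-A′ verbatim, `c = 22`). -/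
theorem trinomialAffineLaw : TrinomialAffineLaw :=
  trinomialAffineLaw_of shiftedAxialBound

end Summit.ValiantsHypothesis.ValiantsHypothesis.Theorems.TwoProducts.RankTwoJacobian

end
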